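import Summits.RiemannHypothesis.RiemannHypothesis.Theorems.GroundBartaEvenWinsBeyondArchDeflationMajorantCut
import HarnessLib

/-!
# RiemannHypothesis / GroundBarta — rung 4 (`EvenWinsBeyondArch`, stmt-RiemannHypothesis-18807 / 18085):
# the endpoint cell — CRUDE bound of the bare window image on a THIN SHELL outside the cut

Helper file (`--supports stmt-RiemannHypothesis-18085`), RH-free, Mathlib + landed tree files only, no definitions, no named
facts.  Prover B (gen 6 of unit `sr-gb-rung-b`).

In the endpoint cell `a* = (log 5)/2` the trial vectors `v = 𝟙_{[-c',c']}·g` are cut at a rational `c'` with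
`a* − c' ≈ 7·10⁻²⁶`, and the PSD datum is taken with the EXTENDED images (indicator widened to a rational `b ≥ a*`,
`b − c' = 10⁻²⁵`).  On the shell `c' < |y| ≤ b` the extended residual is the bare image
`T v(y) = pole(y) + Σ_{n ≤ 4} Λ(n) n^{-1/2}(2v(y) − v(y − log n) − v(y + log n)) + ∫₀^∞ ρ(t)(2v(y) − v(y−t) − v(y+t)) dt`,
an `O(1)` quantity with a logarithmic singularity at `|y| = c'⁺`.  Because the shell is so thin, the crudest bound suffices:

* `dt_shell_image_norm_le` — for `c' < |y| ≤ b`:  `|T v(y)| ≤ G · (K + (3/2) log⁺(1/(|y| − c')))` with `G = sup |g|`,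
  `K = 4c'(cosh(c'/2)cosh(b/2) + sinh(c'/2)sinh(b/2)) + 2Σ_{n ∈ weilPrimeIndex c'} Λ(n)n^{-1/2} + 2∫_1^∞ ρ`;
* `dt_shell_profile_sq_integral_le` — `∫_{c'<|y|≤b} (K + (3/2)log⁺(1/(|y|−c')))² dy ≤ 4δ(K + (3/2)log(1/δ))² + 288δ`
  (`δ = b − c' ≤ 1`; via `log⁺(1/d) ≤ log(1/δ) + 4(d/δ)^{-1/4}`);
* `dt_shell_cross_le` — `|∫_{shell} w · Re(T v_i · conj(T v_j))| ≤ C_w G_i G_j · (4δ(K + (3/2)log(1/δ))² + 288δ)` for `|w| ≤ C_w`.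
-/

set_option linter.dupNamespace false

noncomputable section

open MeasureTheory Set Filter
open scoped Topology ENNReal NNReal ComplexConjugate BigOperators

namespace Summit.RiemannHypothesis.RiemannHypothesis.Theorems.EvenWinsBeyondArch

open Literature.NumberTheory.LFunctions

/-! ## Pointwise bound of the bare image on the shell -/

/-- The pole coefficients of a cut profile: `|∫ v·cosh(x/2)| ≤ 2c'G cosh(c'/2)` and `|∫ v·sinh(x/2)| ≤ 2c'G sinh(c'/2)` for
`v = 𝟙_{[-c',c']}g`, `|g| ≤ G` on the window. [folklore] -/
theorem dt_poleCoeff_norm_le {c' : ℝ} (hc' : 0 < c') {g : ℝ → ℝ} {G : ℝ}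
    (hG : ∀ x ∈ Icc (-c') c', |g x| ≤ G) {v : ℝ → ℂ} (hv : ∀ x, v x = (((Icc (-c') c').indicator g x : ℝ) : ℂ)) :
    ‖∫ x, v x * (Real.cosh (x / 2) : ℂ)‖ ≤ 2 * c' * G * Real.cosh (c' / 2) ∧
      ‖∫ x, v x * (Real.sinh (x / 2) : ℂ)‖ ≤ 2 * c' * G * Real.sinh (c' / 2) := by
  have hG0 : 0 ≤ G := (abs_nonneg _).trans (hG 0 ⟨by linarith, by linarith⟩)
  have hvol : volume (Icc (-c') c') = ENNReal.ofReal (2 * c') := by rw [Real.volume_Icc]; ring_nf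
  have key : ∀ (k : ℝ → ℝ) (Ck : ℝ), Continuous k → (∀ x ∈ Icc (-c') c', |k x| ≤ Ck) →
      ‖∫ x, v x * (k x : ℂ)‖ ≤ 2 * c' * G * Ck := by
    intro k Ck hk hkb
    have e : (fun x ↦ v x * (k x : ℂ)) = (Icc (-c') c').indicator (fun x ↦ ((g x * k x : ℝ) : ℂ)) := by
      funext x
      rw [hv x]
      by_cases hx : x ∈ Icc (-c') c'
      · rw [indicator_of_mem hx, indicator_of_mem hx]; push_cast; ring
      · rw [indicator_of_notMem hx, indicator_of_notMem hx]; simp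
    rw [e, integral_indicator measurableSet_Icc]
    have hb : ∀ x ∈ Icc (-c') c', ‖((g x * k x : ℝ) : ℂ)‖ ≤ G * Ck := by
      intro x hx
      rw [Complex.norm_real, Real.norm_eq_abs, abs_mul]
      exact mul_le_mul (hG x hx) (hkb x hx) (abs_nonneg _) hG0
    have h := norm_setIntegral_le_of_norm_le_const (by rw [hvol]; exact ENNReal.ofReal_lt_top) hb
    rw [Measure.real, hvol, ENNReal.toReal_ofReal (by linarith)] at h
    linarith
  constructor
  · refine key _ _ (by fun_prop) fun x hx ↦ ?_
    rw [abs_of_pos (Real.cosh_pos _), Real.cosh_le_cosh, abs_div, abs_div, abs_two, abs_of_pos hc']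
    exact div_le_div_of_nonneg_right (abs_le.2 ⟨hx.1, hx.2⟩) zero_le_two
  · refine key _ _ (by fun_prop) fun x hx ↦ ?_
    rw [Real.abs_sinh, Real.sinh_le_sinh, abs_div, abs_two]
    exact div_le_div_of_nonneg_right (abs_le.2 ⟨hx.1, hx.2⟩) zero_le_two

/-- **The archimedean layer of a cut vector outside its support**: for `v = 𝟙_{[-c',c']}g`, `|g| ≤ G`, and `c' < |y|`, the
slice `t ↦ ρ(t)|2v(y) − v(y−t) − v(y+t)|` is integrable on `(0, ∞)` with integral
`≤ 2G(¾ log⁺(1/(|y| − c')) + ∫_1^∞ ρ)`. [folklore] -/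
theorem dt_arch_shell_le {c' : ℝ} (hc' : 0 < c') {g : ℝ → ℝ} (hg : Continuous g) {G : ℝ}
    (hG : ∀ x ∈ Icc (-c') c', |g x| ≤ G) {v : ℝ → ℂ} (hv : ∀ x, v x = (((Icc (-c') c').indicator g x : ℝ) : ℂ))
    {y : ℝ} (hy : c' < |y|) :
    IntegrableOn (fun t ↦ weilArchDensity t * ‖2 * v y - v (y - t) - v (y + t)‖) (Ioi 0) ∧
      ∫ t in Ioi 0, weilArchDensity t * ‖2 * v y - v (y - t) - v (y + t)‖ ≤
        2 * G * (3 / 4 * max 0 (-Real.log (|y| - c')) + ∫ t in Ici 1, weilArchDensity t) := by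
  have hG0 : 0 ≤ G := (abs_nonneg _).trans (hG 0 ⟨by linarith, by linarith⟩)
  have hvb : ∀ z, ‖v z‖ ≤ G := by
    intro z
    rw [hv z, Complex.norm_real]
    by_cases hz : z ∈ Icc (-c') c'
    · rw [indicator_of_mem hz, Real.norm_eq_abs]; exact hG z hz
    · rw [indicator_of_notMem hz, norm_zero]; exact hG0
  have hvout : ∀ z, z ∉ Icc (-c') c' → v z = 0 := fun z hz ↦ by rw [hv z, indicator_of_notMem hz]; simp
  have hvm : Measurable v := by
    have e : v = fun y ↦ (((Icc (-c') c').indicator g y : ℝ) : ℂ) := funext hv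
    rw [e]
    exact Complex.measurable_ofReal.comp ((hg.measurable).indicator measurableSet_Icc)
  set d : ℝ := |y| - c' with hdd
  have hd : 0 < d := by rw [hdd]; linarith
  have hvy : v y = 0 := hvout y fun h ↦ by
    have : |y| ≤ c' := abs_le.2 ⟨h.1, h.2⟩
    linarith
  have hzero : ∀ t ∈ Ioo 0 d, ‖2 * v y - v (y - t) - v (y + t)‖ = 0 := by
    intro t ht
    have h1 : y - t ∉ Icc (-c') c' := by
      intro h
      rcases le_or_gt 0 y with h0 | h0
      · have hay : |y| = y := abs_of_nonneg h0
        rw [hdd, hay] at ht; linarith [h.2, ht.2]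
      · have hay : |y| = -y := abs_of_neg h0
        have hout' : c' < -y := hay ▸ hy
        linarith [h.1, ht.1]
    have h2 : y + t ∉ Icc (-c') c' := by
      intro h
      rcases le_or_gt 0 y with h0 | h0
      · have hay : |y| = y := abs_of_nonneg h0
        have hout' : c' < y := hay ▸ hy
        linarith [h.2, ht.1]
      · have hay : |y| = -y := abs_of_neg h0
        rw [hdd, hay] at ht; linarith [h.1, ht.2]
    rw [hvy, hvout _ h1, hvout _ h2]; simp
  have hlarge : ∀ t, ‖2 * v y - v (y - t) - v (y + t)‖ ≤ 2 * G := by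
    intro t
    rw [hvy, mul_zero, zero_sub]
    calc ‖-v (y - t) - v (y + t)‖ ≤ ‖-v (y - t)‖ + ‖v (y + t)‖ := norm_sub_le _ _
      _ ≤ G + G := by rw [norm_neg]; exact add_le_add (hvb _) (hvb _)
      _ = 2 * G := by ring
  set H : ℝ → ℝ := fun t ↦ (Ici d).indicator (fun t ↦ 2 * G * weilArchDensity t) t with hH
  have iR : IntegrableOn (fun t ↦ 2 * G * weilArchDensity t) (Ici d) :=
    (dt_integrableOn_weilArchDensity_Ici hd).const_mul _
  have hHint : IntegrableOn H (Ioi 0) := (iR.integrable_indicator measurableSet_Ici).integrableOn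
  have hdom : ∀ t ∈ Ioi (0 : ℝ), weilArchDensity t * ‖2 * v y - v (y - t) - v (y + t)‖ ≤ H t := by
    intro t (ht : 0 < t)
    have hρ := (weilArchDensity_pos ht).le
    by_cases htd : t < d
    · rw [hzero t ⟨ht, htd⟩, mul_zero, hH]
      simp only
      by_cases h : t ∈ Ici d
      · rw [indicator_of_mem h]; exact mul_nonneg (by positivity) hρ
      · rw [indicator_of_notMem h]
    · rw [hH]
      simp only [indicator_of_mem (show t ∈ Ici d from not_lt.1 htd)]
      calc weilArchDensity t * ‖2 * v y - v (y - t) - v (y + t)‖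
          ≤ weilArchDensity t * (2 * G) := mul_le_mul_of_nonneg_left (hlarge t) hρ
        _ = 2 * G * weilArchDensity t := by ring
  have hmeas : AEStronglyMeasurable (fun t ↦ weilArchDensity t * ‖2 * v y - v (y - t) - v (y + t)‖)
      (volume.restrict (Ioi 0)) := by
    refine (measurable_weilArchDensity.mul ?_).aestronglyMeasurable.restrict
    exact ((measurable_const.sub (hvm.comp (measurable_const.sub measurable_id))).sub
      (hvm.comp (measurable_const.add measurable_id))).norm
  have hint : IntegrableOn (fun t ↦ weilArchDensity t * ‖2 * v y - v (y - t) - v (y + t)‖) (Ioi 0) :=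
    Integrable.mono' hHint hmeas ((ae_restrict_iff' measurableSet_Ioi).2 (Eventually.of_forall
      fun t ht ↦ by
        rw [Real.norm_of_nonneg (mul_nonneg (weilArchDensity_pos ht).le (norm_nonneg _))]
        exact hdom t ht))
  refine ⟨hint, ?_⟩
  have h1 : ∫ t in Ioi 0, weilArchDensity t * ‖2 * v y - v (y - t) - v (y + t)‖ ≤ ∫ t in Ioi 0, H t :=
    setIntegral_mono_on hint hHint measurableSet_Ioi hdom
  have h2 : ∫ t in Ioi 0, H t = 2 * G * ∫ t in Ici d, weilArchDensity t := by
    simp only [hH]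
    rw [integral_indicator measurableSet_Ici, Measure.restrict_restrict measurableSet_Ici,
      inter_eq_left.2 (Ici_subset_Ioi.2 hd), integral_const_mul]
  have h3 := dt_setIntegral_weilArchDensity_Ici_le hd
  calc ∫ t in Ioi 0, weilArchDensity t * ‖2 * v y - v (y - t) - v (y + t)‖
      ≤ 2 * G * ∫ t in Ici d, weilArchDensity t := by rw [← h2]; exact h1
    _ ≤ 2 * G * (3 / 4 * max 0 (-Real.log d) + ∫ t in Ici 1, weilArchDensity t) :=
        mul_le_mul_of_nonneg_left h3 (by positivity)

/-- **Crude bound of the bare three-prime image on the shell.**  For `v = 𝟙_{[-c',c']}g` (`g` continuous, `|g| ≤ G` on the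
window) and `c' < |y| ≤ b`:
`|pole(y) + Σ_{n ∈ weilPrimeIndex c'} Λ(n)n^{-1/2}(2v(y) − v(y−log n) − v(y+log n)) + ∫₀^∞ρ(t)(2v(y) − v(y−t) − v(y+t))dt|`
`≤ G·(4c'(cosh(c'/2)cosh(b/2) + sinh(c'/2)sinh(b/2)) + 2Σ_{n}Λ(n)n^{-1/2} + 2∫_1^∞ρ + (3/2)log⁺(1/(|y| − c')))`. [folklore] -/
theorem dt_shell_image_norm_le {c' b : ℝ} (hc' : 0 < c') {g : ℝ → ℝ} (hg : Continuous g) {G : ℝ}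
    (hG : ∀ x ∈ Icc (-c') c', |g x| ≤ G) {v : ℝ → ℂ} (hv : ∀ x, v x = (((Icc (-c') c').indicator g x : ℝ) : ℂ))
    {y : ℝ} (hy : c' < |y|) (hyb : |y| ≤ b) :
    ‖2 * (∫ x, v x * (Real.cosh (x / 2) : ℂ)) * (Real.cosh (y / 2) : ℂ) -
          2 * (∫ x, v x * (Real.sinh (x / 2) : ℂ)) * (Real.sinh (y / 2) : ℂ) +
        (∑ n ∈ weilPrimeIndex c', (((ArithmeticFunction.vonMangoldt n : ℝ) / Real.sqrt n : ℝ) : ℂ) *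
          (2 * v y - v (y - Real.log n) - v (y + Real.log n))) +
        ∫ t in Ioi 0, (weilArchDensity t : ℂ) * (2 * v y - v (y - t) - v (y + t))‖ ≤
      G * (4 * c' * (Real.cosh (c' / 2) * Real.cosh (b / 2) + Real.sinh (c' / 2) * Real.sinh (b / 2)) +
        2 * (∑ n ∈ weilPrimeIndex c', (ArithmeticFunction.vonMangoldt n : ℝ) / Real.sqrt n) +
        2 * (∫ t in Ici 1, weilArchDensity t) + 3 / 2 * max 0 (-Real.log (|y| - c'))) := by
  have hG0 : 0 ≤ G := (abs_nonneg _).trans (hG 0 ⟨by linarith, by linarith⟩)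
  have hvb : ∀ z, ‖v z‖ ≤ G := by
    intro z
    rw [hv z, Complex.norm_real]
    by_cases hz : z ∈ Icc (-c') c'
    · rw [indicator_of_mem hz, Real.norm_eq_abs]; exact hG z hz
    · rw [indicator_of_notMem hz, norm_zero]; exact hG0
  have hvy : v y = 0 := by
    rw [hv y, indicator_of_notMem]; · simp
    intro h; have : |y| ≤ c' := abs_le.2 ⟨h.1, h.2⟩; linarith
  obtain ⟨hA, hB⟩ := dt_poleCoeff_norm_le hc' hG hv
  -- pole layer
  have hcoshy : ‖(Real.cosh (y / 2) : ℂ)‖ ≤ Real.cosh (b / 2) := by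
    rw [Complex.norm_real, Real.norm_of_nonneg (Real.cosh_pos _).le, Real.cosh_le_cosh, abs_div, abs_div, abs_two,
      abs_of_nonneg (show (0:ℝ) ≤ b by linarith [abs_nonneg y])]
    exact div_le_div_of_nonneg_right hyb zero_le_two
  have hsinhy : ‖(Real.sinh (y / 2) : ℂ)‖ ≤ Real.sinh (b / 2) := by
    rw [Complex.norm_real, Real.norm_eq_abs, Real.abs_sinh, Real.sinh_le_sinh, abs_div, abs_two]
    exact div_le_div_of_nonneg_right hyb zero_le_two
  have hpole : ‖2 * (∫ x, v x * (Real.cosh (x / 2) : ℂ)) * (Real.cosh (y / 2) : ℂ) -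
      2 * (∫ x, v x * (Real.sinh (x / 2) : ℂ)) * (Real.sinh (y / 2) : ℂ)‖ ≤
      G * (4 * c' * (Real.cosh (c' / 2) * Real.cosh (b / 2) + Real.sinh (c' / 2) * Real.sinh (b / 2))) := by
    refine (norm_sub_le _ _).trans ?_
    rw [norm_mul, norm_mul, norm_mul, norm_mul, Complex.norm_ofNat]
    have h1 := mul_le_mul hA hcoshy (norm_nonneg _) (by positivity)
    have h2 := mul_le_mul hB hsinhy (norm_nonneg _) (by positivity)
    nlinarith [h1, h2, norm_nonneg (∫ x, v x * (Real.cosh (x / 2) : ℂ)), norm_nonneg ((Real.cosh (y / 2) : ℂ))]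
  -- prime layer
  have hprime : ‖∑ n ∈ weilPrimeIndex c', (((ArithmeticFunction.vonMangoldt n : ℝ) / Real.sqrt n : ℝ) : ℂ) *
      (2 * v y - v (y - Real.log n) - v (y + Real.log n))‖ ≤
      G * (2 * ∑ n ∈ weilPrimeIndex c', (ArithmeticFunction.vonMangoldt n : ℝ) / Real.sqrt n) := by
    rw [Finset.mul_sum, Finset.mul_sum]
    refine (norm_sum_le _ _).trans (Finset.sum_le_sum fun n _ ↦ ?_)
    have hΛ : 0 ≤ (ArithmeticFunction.vonMangoldt n : ℝ) / Real.sqrt n :=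
      div_nonneg ArithmeticFunction.vonMangoldt_nonneg (Real.sqrt_nonneg _)
    rw [norm_mul, Complex.norm_real, Real.norm_of_nonneg hΛ, hvy, mul_zero, zero_sub]
    have h3 : ‖-v (y - Real.log n) - v (y + Real.log n)‖ ≤ 2 * G := by
      calc ‖-v (y - Real.log n) - v (y + Real.log n)‖ ≤ ‖-v (y - Real.log n)‖ + ‖v (y + Real.log n)‖ := norm_sub_le _ _
        _ ≤ G + G := by rw [norm_neg]; exact add_le_add (hvb _) (hvb _)
        _ = 2 * G := by ring
    calc (ArithmeticFunction.vonMangoldt n : ℝ) / Real.sqrt n * ‖-v (y - Real.log n) - v (y + Real.log n)‖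
        ≤ (ArithmeticFunction.vonMangoldt n : ℝ) / Real.sqrt n * (2 * G) := mul_le_mul_of_nonneg_left h3 hΛ
      _ = G * (2 * ((ArithmeticFunction.vonMangoldt n : ℝ) / Real.sqrt n)) := by ring
  -- archimedean layer
  obtain ⟨hHi, hHm⟩ := dt_arch_shell_le hc' hg hG hv hy
  have harch : ‖∫ t in Ioi 0, (weilArchDensity t : ℂ) * (2 * v y - v (y - t) - v (y + t))‖ ≤
      G * (2 * (∫ t in Ici 1, weilArchDensity t) + 3 / 2 * max 0 (-Real.log (|y| - c'))) := by
    calc ‖∫ t in Ioi 0, (weilArchDensity t : ℂ) * (2 * v y - v (y - t) - v (y + t))‖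
        ≤ ∫ t in Ioi 0, ‖(weilArchDensity t : ℂ) * (2 * v y - v (y - t) - v (y + t))‖ :=
          norm_integral_le_integral_norm _
      _ = ∫ t in Ioi 0, weilArchDensity t * ‖2 * v y - v (y - t) - v (y + t)‖ := by
          refine setIntegral_congr_fun measurableSet_Ioi fun t ht ↦ ?_
          rw [norm_mul, Complex.norm_real, Real.norm_of_nonneg (weilArchDensity_pos ht).le]
      _ ≤ 2 * G * (3 / 4 * max 0 (-Real.log (|y| - c')) + ∫ t in Ici 1, weilArchDensity t) := hHm
      _ = G * (2 * (∫ t in Ici 1, weilArchDensity t) + 3 / 2 * max 0 (-Real.log (|y| - c'))) := by ring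
  calc _ ≤ ‖2 * (∫ x, v x * (Real.cosh (x / 2) : ℂ)) * (Real.cosh (y / 2) : ℂ) -
          2 * (∫ x, v x * (Real.sinh (x / 2) : ℂ)) * (Real.sinh (y / 2) : ℂ) +
        (∑ n ∈ weilPrimeIndex c', (((ArithmeticFunction.vonMangoldt n : ℝ) / Real.sqrt n : ℝ) : ℂ) *
          (2 * v y - v (y - Real.log n) - v (y + Real.log n)))‖ +
        ‖∫ t in Ioi 0, (weilArchDensity t : ℂ) * (2 * v y - v (y - t) - v (y + t))‖ := norm_add_le _ _
    _ ≤ (‖2 * (∫ x, v x * (Real.cosh (x / 2) : ℂ)) * (Real.cosh (y / 2) : ℂ) -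
          2 * (∫ x, v x * (Real.sinh (x / 2) : ℂ)) * (Real.sinh (y / 2) : ℂ)‖ +
        ‖∑ n ∈ weilPrimeIndex c', (((ArithmeticFunction.vonMangoldt n : ℝ) / Real.sqrt n : ℝ) : ℂ) *
          (2 * v y - v (y - Real.log n) - v (y + Real.log n))‖) +
        ‖∫ t in Ioi 0, (weilArchDensity t : ℂ) * (2 * v y - v (y - t) - v (y + t))‖ := by
        gcongr; exact norm_add_le _ _
    _ ≤ _ := by nlinarith [hpole, hprime, harch]

/-! ## The shell profile is square integrable with an explicit bound -/

/-- `log⁺(1/d) ≤ log(1/δ) + 4 d^{-1/4} δ^{1/4}` for `0 < d ≤ δ ≤ 1`. [folklore] -/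
theorem dt_negLog_le_shift {d δ : ℝ} (hd : 0 < d) (hdδ : d ≤ δ) (hδ : δ ≤ 1) :
    max 0 (-Real.log d) ≤ -Real.log δ + 4 * (d ^ (-(1 / 4 : ℝ)) * δ ^ ((1 / 4 : ℝ))) := by
  have hδ0 : 0 < δ := lt_of_lt_of_le hd hdδ
  have h1 : -Real.log d = -Real.log δ + -Real.log (d / δ) := by
    rw [Real.log_div hd.ne' hδ0.ne']; ring
  have h2 : max 0 (-Real.log (d / δ)) ≤ 4 * (d / δ) ^ (-(1 / 4 : ℝ)) := dt_negLog_le_rpow (div_pos hd hδ0)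
  have h3 : (d / δ) ^ (-(1 / 4 : ℝ)) = d ^ (-(1 / 4 : ℝ)) * δ ^ ((1 / 4 : ℝ)) := by
    rw [Real.div_rpow hd.le hδ0.le, Real.rpow_neg hδ0.le, div_inv_eq_mul]
  have h4 : 0 ≤ -Real.log δ := by
    have := Real.log_nonpos hδ0.le hδ; linarith
  have h5 : 0 ≤ -Real.log d := by
    have := Real.log_nonpos hd.le (hdδ.trans hδ); linarith
  rw [max_eq_right h5, h1, ← h3]
  linarith [le_max_right 0 (-Real.log (d / δ))]

/-- Pointwise square bound of the shell profile: for `0 < d ≤ δ ≤ 1` and `K ≥ 0`,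
`(K + (3/2)log⁺(1/d))² ≤ 2(K + (3/2)log(1/δ))² + 72 δ^{1/2} d^{-1/2}`. [folklore] -/
theorem dt_shell_profile_sq_le {d δ K : ℝ} (hd : 0 < d) (hdδ : d ≤ δ) (hδ : δ ≤ 1) (hK : 0 ≤ K) :
    (K + 3 / 2 * max 0 (-Real.log d)) ^ 2 ≤
      2 * (K + 3 / 2 * (-Real.log δ)) ^ 2 + 72 * (δ ^ ((1 / 2 : ℝ)) * d ^ (-(1 / 2 : ℝ))) := by
  have hδ0 : 0 < δ := lt_of_lt_of_le hd hdδ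
  have h := dt_negLog_le_shift hd hdδ hδ
  set X : ℝ := d ^ (-(1 / 4 : ℝ)) * δ ^ ((1 / 4 : ℝ)) with hX
  have hX0 : 0 ≤ X := mul_nonneg (Real.rpow_nonneg hd.le _) (Real.rpow_nonneg hδ0.le _)
  have hX2 : X ^ 2 = δ ^ ((1 / 2 : ℝ)) * d ^ (-(1 / 2 : ℝ)) := by
    rw [hX, mul_pow, ← Real.rpow_natCast, ← Real.rpow_natCast, ← Real.rpow_mul hd.le, ← Real.rpow_mul hδ0.le]
    norm_num; ring
  have hL : 0 ≤ -Real.log δ := by have := Real.log_nonpos hδ0.le hδ; linarith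
  have hm0 : 0 ≤ max 0 (-Real.log d) := le_max_left _ _
  have hA : K + 3 / 2 * max 0 (-Real.log d) ≤ (K + 3 / 2 * (-Real.log δ)) + 6 * X := by linarith
  have hB : 0 ≤ K + 3 / 2 * max 0 (-Real.log d) := by positivity
  calc (K + 3 / 2 * max 0 (-Real.log d)) ^ 2 ≤ ((K + 3 / 2 * (-Real.log δ)) + 6 * X) ^ 2 :=
        pow_le_pow_left₀ hB hA 2
    _ ≤ 2 * (K + 3 / 2 * (-Real.log δ)) ^ 2 + 2 * (6 * X) ^ 2 := by
        nlinarith [sq_nonneg ((K + 3 / 2 * (-Real.log δ)) - 6 * X)]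
    _ = 2 * (K + 3 / 2 * (-Real.log δ)) ^ 2 + 72 * (δ ^ ((1 / 2 : ℝ)) * d ^ (-(1 / 2 : ℝ))) := by
        rw [mul_pow, hX2]; ring

/-- `∫_{c'}^{b} δ^{1/2}(y − c')^{-1/2} dy = 2δ` for `δ = b − c' > 0`. [folklore] -/
theorem dt_integral_shell_rpow {c' b : ℝ} (hcb : c' < b) :
    ∫ y in c'..b, (b - c') ^ ((1 / 2 : ℝ)) * (y - c') ^ (-(1 / 2 : ℝ)) = 2 * (b - c') := by
  have hδ : 0 < b - c' := by linarith
  rw [intervalIntegral.integral_const_mul, intervalIntegral.integral_comp_sub_right (fun u ↦ u ^ (-(1 / 2 : ℝ))) c',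
    sub_self, integral_rpow (Or.inl (by norm_num : (-1 : ℝ) < -(1 / 2)))]
  have e1 : (-(1 / 2 : ℝ)) + 1 = 1 / 2 := by norm_num
  rw [e1, Real.zero_rpow (by norm_num : (1 / 2 : ℝ) ≠ 0), sub_zero]
  have e2 : (b - c') ^ ((1 / 2 : ℝ)) * (b - c') ^ ((1 / 2 : ℝ)) = b - c' := by
    rw [← Real.rpow_add hδ]; norm_num
  calc (b - c') ^ ((1 / 2 : ℝ)) * ((b - c') ^ ((1 / 2 : ℝ)) / (1 / 2))
      = 2 * ((b - c') ^ ((1 / 2 : ℝ)) * (b - c') ^ ((1 / 2 : ℝ))) := by ring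
    _ = 2 * (b - c') := by rw [e2]

/-- **The shell profile integral (right shell)**: for `0 < c' < b`, `b − c' ≤ 1`, `K ≥ 0`,
`∫_{(c', b]} (K + (3/2)log⁺(1/(|y| − c')))² dy ≤ 2δ(K + (3/2)log(1/δ))² + 144δ`, `δ = b − c'`. [folklore] -/
theorem dt_shell_profile_sq_integral_right {c' b K : ℝ} (hc' : 0 < c') (hcb : c' < b) (hδ1 : b - c' ≤ 1) (hK : 0 ≤ K) :
    IntegrableOn (fun y : ℝ ↦ (K + 3 / 2 * max 0 (-Real.log (|y| - c'))) ^ 2) (Ioc c' b) ∧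
    ∫ y in Ioc c' b, (K + 3 / 2 * max 0 (-Real.log (|y| - c'))) ^ 2 ≤
      2 * (b - c') * (K + 3 / 2 * (-Real.log (b - c'))) ^ 2 + 144 * (b - c') := by
  have hδ : 0 < b - c' := by linarith
  set p : ℝ → ℝ := fun y ↦ 2 * (K + 3 / 2 * (-Real.log (b - c'))) ^ 2 +
    72 * ((b - c') ^ ((1 / 2 : ℝ)) * (y - c') ^ (-(1 / 2 : ℝ))) with hp
  set q : ℝ → ℝ := fun y ↦ (K + 3 / 2 * max 0 (-Real.log (|y| - c'))) ^ 2 with hq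
  -- `q ≤ p` on the shell
  have hqp : ∀ y ∈ Ioc c' b, q y ≤ p y := by
    intro y hy
    have hy0 : 0 < y := hc'.trans hy.1
    simp only [hq, hp, abs_of_pos hy0]
    exact dt_shell_profile_sq_le (by linarith [hy.1]) (by linarith [hy.2]) hδ1 hK
  -- integrability of `p` on `[c', b]`
  have hr : IntervalIntegrable (fun y : ℝ ↦ (y - c') ^ (-(1 / 2 : ℝ))) volume c' b := by
    have h := (intervalIntegral.intervalIntegrable_rpow' (a := 0) (b := b - c')
      (by norm_num : (-1 : ℝ) < -(1 / 2))).comp_sub_right c'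
    rw [zero_add, show b - c' + c' = b by ring] at h
    exact h
  have hpI : IntervalIntegrable p volume c' b :=
    (intervalIntegrable_const.add ((hr.const_mul _).const_mul _))
  have hpIO : IntegrableOn p (Ioc c' b) := (intervalIntegrable_iff_integrableOn_Ioc_of_le hcb.le).1 hpI
  -- measurability and integrability of `q`
  have hqm : AEStronglyMeasurable q (volume.restrict (Ioc c' b)) := by
    refine (Measurable.pow_const ((measurable_const.add (measurable_const.mul ?_))) 2).aestronglyMeasurable.restrict
    exact measurable_const.max (Real.measurable_log.comp (continuous_abs.measurable.sub measurable_const)).neg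
  have hq0 : ∀ y, 0 ≤ q y := fun y ↦ by simp only [hq]; positivity
  have hqIO : IntegrableOn q (Ioc c' b) :=
    Integrable.mono' hpIO hqm ((ae_restrict_iff' measurableSet_Ioc).2 (Eventually.of_forall fun y hy ↦ by
      rw [Real.norm_of_nonneg (hq0 y)]; exact hqp y hy))
  refine ⟨hqIO, ?_⟩
  have hmono : ∫ y in Ioc c' b, q y ≤ ∫ y in Ioc c' b, p y :=
    setIntegral_mono_on hqIO hpIO measurableSet_Ioc hqp
  have hval : ∫ y in Ioc c' b, p y = 2 * (b - c') * (K + 3 / 2 * (-Real.log (b - c'))) ^ 2 + 144 * (b - c') := by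
    rw [← intervalIntegral.integral_of_le hcb.le]
    simp only [hp]
    rw [intervalIntegral.integral_add intervalIntegrable_const ((hr.const_mul _).const_mul _),
      intervalIntegral.integral_const, intervalIntegral.integral_const_mul, dt_integral_shell_rpow hcb, smul_eq_mul]
    ring
  linarith

/-- **The shell profile integral (left shell)**: the mirror image of `dt_shell_profile_sq_integral_right`. [folklore] -/
theorem dt_shell_profile_sq_integral_left {c' b K : ℝ} (hc' : 0 < c') (hcb : c' < b) (hδ1 : b - c' ≤ 1) (hK : 0 ≤ K) :
    IntegrableOn (fun y : ℝ ↦ (K + 3 / 2 * max 0 (-Real.log (|y| - c'))) ^ 2) (Ico (-b) (-c')) ∧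
    ∫ y in Ico (-b) (-c'), (K + 3 / 2 * max 0 (-Real.log (|y| - c'))) ^ 2 ≤
      2 * (b - c') * (K + 3 / 2 * (-Real.log (b - c'))) ^ 2 + 144 * (b - c') := by
  obtain ⟨hI, hle⟩ := dt_shell_profile_sq_integral_right hc' hcb hδ1 hK
  set q : ℝ → ℝ := fun y ↦ (K + 3 / 2 * max 0 (-Real.log (|y| - c'))) ^ 2 with hq
  have hqe : ∀ y, q (-y) = q y := fun y ↦ by simp only [hq, abs_neg]
  -- reflect: `y ↦ -y` maps `Ico (-b) (-c')` onto `Ioc c' b`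
  have hI' : IntegrableOn q (Ico (-b) (-c')) := by
    have h := (hI.comp_neg)
    have e : -(Ioc c' b) = Ico (-b) (-c') := by
      ext y; simp only [Set.mem_neg, mem_Ioc, mem_Ico]; constructor <;> rintro ⟨h1, h2⟩ <;> constructor <;> linarith
    rw [← e]
    refine (h.congr_fun (fun y _ ↦ ?_) measurableSet_Ioc.neg)
    exact hqe y
  refine ⟨hI', ?_⟩
  have e2 : ∫ y in Ico (-b) (-c'), q y = ∫ y in Ioc c' b, q y := by
    rw [← intervalIntegral.integral_of_le hcb.le, setIntegral_congr_set Ico_ae_eq_Ioc,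
      ← intervalIntegral.integral_of_le (by linarith : -b ≤ -c')]
    have h := intervalIntegral.integral_comp_neg (a := c') (b := b) (f := q)
    simp only [hqe] at h
    exact h.symm
  rw [e2]; exact hle

end Summit.RiemannHypothesis.RiemannHypothesis.Theorems.EvenWinsBeyondArch

end
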